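import Summits.QuantumFields.BalabanUV.Beta.D1BFx.RProjectorRange
import Summits.QuantumFields.BalabanUV.Beta.D1BFx.GhostStencil
import Literature.MathematicalPhysics.QuantumFieldTheory.Balaban1983to89.Beta.BalabanStepJetsSucc

/-!
# `BalabanUV.Beta.D1BFx.RProjectorJet` — road «BF-x» for binder row D1, leaf J5 (KERNEL LEVEL, part 1): THE COLOUR-STRIPPED SITE JET
# `Ṙ_s(κ′,u)` OF BAŁABAN'S GAUGE PROJECTION `R(U)` AT `U = 1` ALONG ONE FINE BOND — as an explicit composition of the typed `U = 1` kernels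
# (the ghost leg `Ggh` (T2), the projector `Pgt` (J5.0), the ghost stencil `Sgh` (T6), the averaging jet `qJet` (T6) against `kerP` (J5.0)),
# with its sockets: antisymmetry, bi-localisation at the bond (rate `δ/n`, explicit constants), block-translation covariance

HONEST DEPENDENCY (page 1, mandatory): continuum YM on T⁴ ⇐ BetaPertH ∧ nine spine estimates (0/9 proved); BetaPertH ⇐ (D1) ∧ (D4) ∧
CAP+tail; G-an2-4 gates asym, D1 and NE2/3/4.  HONEST FRAMING: discharging `BetaPertH` makes Bałaban's UV stability UNCONDITIONAL — NOT
the continuum limit and NOT the Clay problem.  THIS FILE DISCHARGES NOTHING: it types ONE OBJECT (a definition asserting nothing) and proves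
[folklore] bookkeeping about it (antisymmetry, exponential majorants by the tree's composition bricks, translation); 0 binders of row D1 are
touched.  ABSOLUTE RULE (cell charter, verbatim): «No internally-minted statement may enter as a cited fact. Every hypothesis is either
kernel-proved in this package or a verbatim quotation of a PUBLISHED theorem with page reference. The manuscript(s) under audit are NOT
citable for their own disputed steps — they are the thing under adjudication; programme-internal (2001/route/tribunal) claims are never
citable.»  Accordingly there is NO `def … : Prop` below and no hypothesis of any theorem is a printed statement.

WHAT IS TYPED (skeleton `HOME/beta/skeletons/D1-b2b-balaban-beta-d1-p2.md` v1.4 node J, leaf J5 «GAUGE-TERM jets `∂_A(D_A R_A D_A*)|₀`»;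
`TYPER-SPEC-D1BFx.md` §3; leaf-09-g2's J5.0 `D1BFx/RProjector(Range)` and reading note `CHECK-K-R2.md` §6 ([B9] p. 394 (3.21)/(3.25) =
LOCATOR ONLY: `R = 1 − P`, `P = G′Q′*(Q′G′²Q′*)⁻¹Q′G′`, `G′ = (Δ_U + Q′(U)*aQ′(U))⁻¹`); the MODEL-LEVEL dictionary is this seat's
`D1BFx/ProjectorJet` (p211500: `cojet`, uniqueness), `D1BFx/ProjectorJetDeriv` (p211779: it IS the derivative) and `D1BFx/ProjectorJetStripped`
(`cojetSkew_balaban_of_skew`: along `(Ġ′ = −G′·V·G′, Q̇′)` with the STRIPPED jets `V` (skew) and `(Q̇′ᴴ)_s`,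
`Ṙ_s = R·G′·V·P + P·V·G′·R − (R·G′·(Q̇′ᴴ)_s·X⁺ − h.c.)`, `X = G′Q′*`, `X⁺ = (XᴴX)⁻¹Xᴴ`, and `(R·G′·V·P)ᵀ = −P·V·G′·R`)):
* §1 [our object, GENERIC in four site kernels] `RG G P := G − P∘G` (`= R∘G′`), `cornerV G P V := (RG G P)∘V∘P`, `cornerJ G P J := (RG G P)∘J`,
  **`rdotOf G P V J := (cornerV − (cornerV)ᵀ) − (cornerJ − (cornerJ)ᵀ)`** (`ExpKernelCalculus.comp`, `TameKernelCalculus.trK`) — for `G`, `P`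
  symmetric and `V` antisymmetric this is the displayed `Ṙ_s` with `J := (Q̇′ᴴ)_s·X⁺`; ANTISYMMETRIC by construction (`trK_rdotOf`).
* §2 [folklore] SOCKETS of the generic object: `biLoc_rdotOf` — `Decays G`, `Decays P`, `BiLoc V u u`, `BiLoc J u u` at a common rate `δ` ⟹
  `BiLoc (rdotOf G P V J) u u (cRdot …) (δ/8)` (bricks `BalabanStepJetsSucc.decays_comp`/`biLoc_comp_right`, `ExpKernelCalculus.biLoc_comp_decays`,
  `KernelWard.biLoc_sub`, `TameKernelCalculus.biLoc_trK`); `rdotOf_shiftK` — translation covariance from that of the four inputs.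
* §3 [our object] the coarse piece **`Jq n a κ′ u s q := −qJet n κ′ u (blk s) s · kerP (n−1) a q (blk s)`** = `((Q̇′ᴴ)_s·X⁺)(s,q)`: the stripped
  ADJOINT averaging jet is `(Q̇′ᴴ)_s(s,y) = −n⁴·qJet n κ′ u y s` (T6's convention, in which `qAnti = Q′*·Q̇′ + Q̇′*·Q′` with `Q̇′ ↦ qJet`,
  `Q̇′* ↦ −n⁴·qJetᵀ`, `GhostStencil` §3) and `X⁺(y,q) = n⁻⁴·kerP q y` (so that `X·X⁺ = Pker`, `RProjector.Pker`'s normalisation); the block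
  sum over `y` collapses on the guard `[blk s = y]`.  Sockets `biLoc_Jq` (from `abs_qJet_le`, `abs_kerP_le`, the block geometry `l1_sub_le_blk`),
  `Jq_translate` (given the block covariance of `kerP`, an explicit binder `hkerP` until leaf-05-g3's J5-asm exposes it).
* §4 [our object, THE INSTANCE] **`Rdot n a cK cQ κ′ u := rdotOf (Ggh n a) (Pgt n a) (Sgh n cK cQ κ′ u) (Jq n a κ′ u)`** — the stripped site jet
  of `R(U)` at `U = 1` along the fine bond `⟨u, u + e_κ′⟩`, the `V`-slot being the jet of `Δ′_a(U) = Δ_U + a·Q′(U)*Q′(U)` in the AX units of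
  `GhostLeg` (T6's `Sgh n cK cQ`, weights `(cK, cQ)` REAL PARAMETERS — their identification `(n², a)` up to colour weight/sign is the owner's
  CHECK-N0, nothing asserted); sockets `Rdot_antisymm`, **`biLoc_Rdot`** (given `Decays (Pgt n a) CP (dJ a / n)` — leaf-05-g3's `decays_Pgt`,
  weakened — an explicit binder here), `exists_biLoc_Rdot`, **`Rdot_translate`** (given the block covariance of `Pgt` and `kerP`, binders).
NOT HERE: the bond-level assembly `∂(D·R·D*) = Ḋ·R·D* + D·R·Ḋ* + D·Ṙ·D*` (leaf-05-g3's `D1BFx/RJetAssembly`, which consumes `Rdot` BY NAME);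
the kernel-level Leibniz identities `R∘Ṙ_s + Ṙ_s∘R = Ṙ_s`, `Ṙ_s∘X + R∘Ẋ_s = 0` (part 2); `decays_Pgt`/`shiftK_Pgt` (leaf-05-g3); colour
weights; any `n`-uniformity beyond the displayed constants.  Unit `b2b-balaban-beta-d1-formalise-leaf-07` (gen 2).
-/

namespace Summit.QuantumFields.BalabanUV.Beta.D1BFx.RProjectorJet

open Literature.MathematicalPhysics.QuantumFieldTheory.Balaban1983to89
open Literature.MathematicalPhysics.QuantumFieldTheory.Balaban1983to89.Beta
open B12Sec2to5 (l1 l1_nonneg)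
open B6QGQLower276 (X side blk loc side_mul_blk_add_loc loc_nonneg loc_lt)
open B6QGQDecay237 (deltaU deltaU_pos)
open ExpKernelCalculus (Site MKer Decays BiLoc comp shiftK comp_shiftK Zl Zl_nonneg biLoc_comp_decays)
open BalabanStepJetsSucc (decays_comp biLoc_comp_right)
open KernelWard (biLoc_sub)
open Summit.QuantumFields.BalabanUV.Beta.TameKernelCalculus (trK trK_apply trK_trK trK_sub trK_comp decays_of_le biLoc_of_le biLoc_trK)
open GhostLeg (Ggh Ggh_symm decays_Ggh shiftK_Ggh_neg const_nonneg side_pred)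
open GhostStencil (qJet Sgh Sgh_antisymm Sgh_translate biLoc_Sgh abs_qJet_le qJet_eq_zero qJet_translate blk_translate'
  l1_sub_le_of_blk_eq)
open RProjector (kerP Pgt Pgt_apply Pgt_symm abs_kerP_le cP deltaP cP_nonneg deltaP_pos)

noncomputable section

/-! ## §1 The generic object -/

section Generic

variable (G P V J : MKer 4 Unit)

/-- [our object] `R∘G′ = G′ − P∘G′` for `R = 1 − P`. -/
def RG : MKer 4 Unit := G - comp P G

/-- [our object] The `V`-corner `R·G′·V·P`. -/
def cornerV : MKer 4 Unit := comp (comp (RG G P) V) P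

/-- [our object] The `Q̇`-corner `R·G′·J`, `J = (Q̇′ᴴ)_s·X⁺`. -/
def cornerJ : MKer 4 Unit := comp (RG G P) J

/-- [our object] **THE GENERIC STRIPPED JET** `rdotOf G P V J := (cornerV − cornerVᵀ) − (cornerJ − cornerJᵀ)` — the kernel transcription of
`ProjectorJetStripped.cojetSkew_balaban_of_skew` (`R·G′·V·P + P·V·G′·R − (R·G′·J − (R·G′·J)ᵀ)` with `P·V·G′·R = −(R·G′·V·P)ᵀ` for
`G′`, `P` symmetric, `V` antisymmetric).  A definition; asserts nothing. -/
def rdotOf : MKer 4 Unit := (cornerV G P V - trK (cornerV G P V)) - (cornerJ G P J - trK (cornerJ G P J))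

/-- [our object] Unfolding. -/
theorem rdotOf_def : rdotOf G P V J = (cornerV G P V - trK (cornerV G P V)) - (cornerJ G P J - trK (cornerJ G P J)) := rfl

/-- [folklore] **ANTISYMMETRY** (the stripped jet of a symmetric operator is skew, `ProjectorJetStripped` §2): `(Ṙ_s)ᵀ = −Ṙ_s`. -/
theorem trK_rdotOf : trK (rdotOf G P V J) = -rdotOf G P V J := by
  rw [rdotOf, trK_sub, trK_sub, trK_sub, trK_trK, trK_trK]
  abel

/-- [folklore] Antisymmetry, pointwise. -/
theorem rdotOf_antisymm (x z : Site 4) (a b : Unit) : rdotOf G P V J z x b a = -rdotOf G P V J x z a b := by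
  have h := congrFun (congrFun (congrFun (congrFun (trK_rdotOf G P V J) x) z) a) b
  rwa [trK_apply] at h

end Generic

/-! ## §2 Sockets of the generic object: bi-localisation and translation -/

section Bounds

variable {G P V J : MKer 4 Unit} {CG CP CV CJ δ : ℝ} {u : Site 4}

/-- [folklore] `|Unit| = 1` as a real factor. -/
theorem card_unit_real : (Fintype.card Unit : ℝ) = 1 := by simp

/-- [folklore] Difference of two decaying kernels. -/
theorem decays_sub' {A B : MKer 4 Unit} {CA CB δ' : ℝ} (hA : Decays A CA δ') (hB : Decays B CB δ') : Decays (A - B) (CA + CB) δ' := by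
  intro x y a b
  show |A x y a b - B x y a b| ≤ _
  calc |A x y a b - B x y a b| ≤ |A x y a b| + |B x y a b| := abs_sub _ _
    _ ≤ _ := by rw [add_mul]; exact add_le_add (hA x y a b) (hB x y a b)

/-- [folklore] Enlarging the constant of a `BiLoc` bound. -/
theorem biLoc_mono_const {K : MKer 4 Unit} {p q : Site 4} {C C' δ' : ℝ} (h : BiLoc K p q C δ') (hC : C ≤ C') : BiLoc K p q C' δ' :=
  fun x y a b => (h x y a b).trans (mul_le_mul_of_nonneg_right hC (Real.exp_pos _).le)

/-- [our object] The constant of `R∘G′` at rate `δ/2`. -/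
def cRG (CG CP δ : ℝ) : ℝ := |CG| + (Fintype.card Unit : ℝ) * (CP * CG) * Zl 4 (δ - δ / 2)

/-- [folklore] `Decays (RG G P) (cRG CG CP δ) (δ/2)`. -/
theorem decays_RG (hG : Decays G CG δ) (hP : Decays P CP δ) (hδ : 0 < δ) : Decays (RG G P) (cRG CG CP δ) (δ / 2) := by
  have h1 : Decays (comp P G) ((Fintype.card Unit : ℝ) * (CP * CG) * Zl 4 (δ - δ / 2)) (δ / 2) :=
    decays_comp hP hG (by linarith) (by linarith)
  have h2 : Decays G (|CG|) (δ / 2) := decays_of_le hG (by linarith)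
  exact decays_sub' h2 h1

/-- [our object] The constant of `(R∘G′)∘V` at rate `δ/4`. -/
def cRGV (CG CP CV δ : ℝ) : ℝ := (Fintype.card Unit : ℝ) * (cRG CG CP δ * |CV|) * Zl 4 (δ / 2 - δ / 4)

/-- [folklore] `BiLoc ((RG G P)∘V) u u (cRGV …) (δ/4)`. -/
theorem biLoc_RGV (hG : Decays G CG δ) (hP : Decays P CP δ) (hV : BiLoc V u u CV δ) (hδ : 0 < δ) :
    BiLoc (comp (RG G P) V) u u (cRGV CG CP CV δ) (δ / 4) := by
  have hV' : BiLoc V u u (|CV|) (δ / 2) := biLoc_of_le hV (by linarith)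
  exact biLoc_comp_decays (decays_RG hG hP hδ) hV' (by linarith) (by linarith)

/-- [our object] The constant of the `V`-corner at rate `δ/8`. -/
def cCornerV (CG CP CV δ : ℝ) : ℝ := (Fintype.card Unit : ℝ) * (cRGV CG CP CV δ * |CP|) * Zl 4 (δ / 4 - δ / 8)

/-- [folklore] **`BiLoc (cornerV G P V) u u (cCornerV …) (δ/8)`**. -/
theorem biLoc_cornerV (hG : Decays G CG δ) (hP : Decays P CP δ) (hV : BiLoc V u u CV δ) (hδ : 0 < δ) :
    BiLoc (cornerV G P V) u u (cCornerV CG CP CV δ) (δ / 8) := by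
  have hP' : Decays P (|CP|) (δ / 4) := decays_of_le hP (by linarith)
  exact biLoc_comp_right (biLoc_RGV hG hP hV hδ) hP' (by linarith) (by linarith)

/-- [our object] The constant of the `Q̇`-corner at rate `δ/8`. -/
def cCornerJ (CG CP CJ δ : ℝ) : ℝ := (Fintype.card Unit : ℝ) * (cRG CG CP δ * |CJ|) * Zl 4 (δ / 2 - δ / 8)

/-- [folklore] **`BiLoc (cornerJ G P J) u u (cCornerJ …) (δ/8)`**. -/
theorem biLoc_cornerJ (hG : Decays G CG δ) (hP : Decays P CP δ) (hJ : BiLoc J u u CJ δ) (hδ : 0 < δ) :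
    BiLoc (cornerJ G P J) u u (cCornerJ CG CP CJ δ) (δ / 8) := by
  have hJ' : BiLoc J u u (|CJ|) (δ / 2) := biLoc_of_le hJ (by linarith)
  exact biLoc_comp_decays (decays_RG hG hP hδ) hJ' (by linarith) (by linarith)

/-- [our object] The constant of the jet at rate `δ/8`. -/
def cRdot (CG CP CV CJ δ : ℝ) : ℝ := (cCornerV CG CP CV δ + cCornerV CG CP CV δ) + (cCornerJ CG CP CJ δ + cCornerJ CG CP CJ δ)

/-- [folklore] **BI-LOCALISATION OF THE GENERIC JET AT THE BOND**: `Decays G CG δ`, `Decays P CP δ`, `BiLoc V u u CV δ`, `BiLoc J u u CJ δ`,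
`0 < δ` ⟹ `BiLoc (rdotOf G P V J) u u (cRdot CG CP CV CJ δ) (δ/8)`. -/
theorem biLoc_rdotOf (hG : Decays G CG δ) (hP : Decays P CP δ) (hV : BiLoc V u u CV δ) (hJ : BiLoc J u u CJ δ) (hδ : 0 < δ) :
    BiLoc (rdotOf G P V J) u u (cRdot CG CP CV CJ δ) (δ / 8) := by
  have h1 := biLoc_cornerV hG hP hV hδ
  have h2 := biLoc_cornerJ hG hP hJ hδ
  exact biLoc_sub (biLoc_sub h1 (biLoc_trK h1)) (biLoc_sub h2 (biLoc_trK h2))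

/-- [folklore] `shiftK` commutes with transposition. -/
theorem trK_shiftK (s : Site 4) (K : MKer 4 Unit) : trK (shiftK s K) = shiftK s (trK K) := rfl

/-- [folklore] `shiftK` is additive (subtraction). -/
theorem shiftK_sub (s : Site 4) (K L : MKer 4 Unit) : shiftK s (K - L) = shiftK s K - shiftK s L := rfl

/-- [folklore] **TRANSLATION COVARIANCE OF THE GENERIC JET**: if `G` and `P` are `s`-invariant then translating `V` and `J` by `s` translates
the jet by `s`. -/
theorem rdotOf_shiftK {G P : MKer 4 Unit} {s : Site 4} (hG : shiftK s G = G) (hP : shiftK s P = P) (V J : MKer 4 Unit) :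
    rdotOf G P (shiftK s V) (shiftK s J) = shiftK s (rdotOf G P V J) := by
  have hRG : shiftK s (RG G P) = RG G P := by
    rw [RG, shiftK_sub, ← comp_shiftK, hG, hP]
  have hCV : cornerV G P (shiftK s V) = shiftK s (cornerV G P V) := by
    rw [cornerV, cornerV, ← comp_shiftK, ← comp_shiftK, hRG, hP]
  have hCJ : cornerJ G P (shiftK s J) = shiftK s (cornerJ G P J) := by
    rw [cornerJ, cornerJ, ← comp_shiftK, hRG]
  rw [rdotOf, rdotOf, hCV, hCJ, trK_shiftK, trK_shiftK, shiftK_sub, shiftK_sub, shiftK_sub]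

end Bounds

/-! ## §3 The coarse piece `J = (Q̇′ᴴ)_s·X⁺` of the `Q̇`-corner -/

section Coarse

variable (n : ℕ) (a : ℝ) (κ' : Fin 4) (u : Site 4)

/-- [our object] **THE COARSE PIECE OF THE `Q̇`-CORNER**: `Jq n a κ′ u s q := −qJet n κ′ u (blk s) s · kerP (n−1) a q (blk s)` =
`Σ_y (Q̇′ᴴ)_s(s,y)·X⁺(y,q)` with `(Q̇′ᴴ)_s(s,y) = −n⁴·qJet n κ′ u y s` (T6's adjoint convention) and `X⁺(y,q) = n⁻⁴·kerP q y` (J5.0's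
normalisation: `X·X⁺ = Pker`), the sum collapsing on `y = blk s`.  A definition; asserts nothing. -/
def Jq : MKer 4 Unit := fun s q _ _ => -(qJet n κ' u (blk (n - 1) s) s * kerP (d := 4) (n - 1) a q (blk (n - 1) s))

/-- [our object] Unfolding. -/
theorem Jq_apply (s q : Site 4) (v w : Unit) :
    Jq n a κ' u s q v w = -(qJet n κ' u (blk (n - 1) s) s * kerP (d := 4) (n - 1) a q (blk (n - 1) s)) := rfl

/-- [folklore] Off the block of the bond the coarse piece vanishes: `blk s ≠ blk u ⟹ Jq … s q = 0`. -/
theorem Jq_eq_zero_of_ne {s : Site 4} (hs : blk (n - 1) u ≠ blk (n - 1) s) (q : Site 4) (v w : Unit) : Jq n a κ' u s q v w = 0 := by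
  rw [Jq_apply, qJet_eq_zero κ' u n (fun h => hs h.2), zero_mul, neg_zero]

/-- [folklore] **BLOCK GEOMETRY**: two fine sites are `ℓ¹`-close up to their block distance, `l1 (q − u) ≤ 4n·dist (blk q) (blk u) + 4n`
(block side `n`; per coordinate `q = n·blk q + loc`, `0 ≤ loc < n`). -/
theorem l1_sub_le_blk [NeZero n] (q w : Site 4) :
    l1 (q - w) ≤ 4 * (n : ℝ) * dist (blk (n - 1) q) (blk (n - 1) w) + 4 * (n : ℝ) := by
  have hn : (0 : ℝ) < n := Nat.cast_pos.mpr (Nat.pos_of_ne_zero (NeZero.ne n))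
  have hμ : ∀ μ : Fin 4, |(((q - w) μ : ℤ) : ℝ)| ≤ (n : ℝ) * dist (blk (n - 1) q) (blk (n - 1) w) + n := by
    intro μ
    have h1 := side_mul_blk_add_loc (n - 1) q μ; have h2 := side_mul_blk_add_loc (n - 1) w μ
    have h3 := loc_nonneg (n - 1) q μ; have h4 := loc_lt (n - 1) q μ
    have h5 := loc_nonneg (n - 1) w μ; have h6 := loc_lt (n - 1) w μ
    rw [side_pred] at h1 h2 h4 h6
    have h7 : (q - w) μ = (n : ℤ) * (blk (n - 1) q μ - blk (n - 1) w μ) + (loc (n - 1) q μ - loc (n - 1) w μ) := by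
      rw [Pi.sub_apply]; linarith
    have hd : |(((blk (n - 1) q μ - blk (n - 1) w μ : ℤ)) : ℝ)| ≤ dist (blk (n - 1) q) (blk (n - 1) w) := by
      have := dist_le_pi_dist (blk (n - 1) q) (blk (n - 1) w) μ
      rwa [Int.dist_eq, ← Int.cast_sub] at this
    have hloc : |(((loc (n - 1) q μ - loc (n - 1) w μ : ℤ)) : ℝ)| ≤ n := by
      rw [abs_le]; push_cast
      obtain ⟨h3', h4'⟩ : (0 : ℝ) ≤ ((loc (n - 1) q μ : ℤ) : ℝ) ∧ ((loc (n - 1) q μ : ℤ) : ℝ) < n := ⟨by exact_mod_cast h3, by exact_mod_cast h4⟩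
      obtain ⟨h5', h6'⟩ : (0 : ℝ) ≤ ((loc (n - 1) w μ : ℤ) : ℝ) ∧ ((loc (n - 1) w μ : ℤ) : ℝ) < n := ⟨by exact_mod_cast h5, by exact_mod_cast h6⟩
      constructor <;> linarith
    rw [h7]; push_cast
    calc |(n : ℝ) * (((blk (n - 1) q μ : ℤ) : ℝ) - ((blk (n - 1) w μ : ℤ) : ℝ)) + (((loc (n - 1) q μ : ℤ) : ℝ) - ((loc (n - 1) w μ : ℤ) : ℝ))|
        ≤ |(n : ℝ) * (((blk (n - 1) q μ : ℤ) : ℝ) - ((blk (n - 1) w μ : ℤ) : ℝ))| + |((loc (n - 1) q μ : ℤ) : ℝ) - ((loc (n - 1) w μ : ℤ) : ℝ)| :=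
          abs_add_le _ _
      _ ≤ (n : ℝ) * dist (blk (n - 1) q) (blk (n - 1) w) + n := by
          rw [abs_mul, abs_of_pos hn]
          refine add_le_add (mul_le_mul_of_nonneg_left ?_ hn.le) ?_
          · exact_mod_cast hd
          · exact_mod_cast hloc
  unfold l1
  calc ∑ μ, |(((q - w) μ : ℤ) : ℝ)| ≤ ∑ _μ : Fin 4, ((n : ℝ) * dist (blk (n - 1) q) (blk (n - 1) w) + n) := Finset.sum_le_sum fun μ _ => hμ μ
    _ = 4 * (n : ℝ) * dist (blk (n - 1) q) (blk (n - 1) w) + 4 * (n : ℝ) := by simp; ring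

/-- [folklore] From block-distance decay to fine `ℓ¹` decay at rate `δ/(4n)`, losing a factor `e^{δ}`. -/
theorem exp_blk_le [NeZero n] {δ : ℝ} (hδ : 0 ≤ δ) (q w : Site 4) :
    Real.exp (-(δ * dist (blk (n - 1) q) (blk (n - 1) w))) ≤ Real.exp δ * Real.exp (-(δ / (4 * n)) * l1 (q - w)) := by
  have hn : (0 : ℝ) < n := Nat.cast_pos.mpr (Nat.pos_of_ne_zero (NeZero.ne n))
  have h := l1_sub_le_blk n q w
  rw [← Real.exp_add, Real.exp_le_exp]
  have h4n : (0 : ℝ) < 4 * n := by positivity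
  have key : δ / (4 * n) * l1 (q - w) ≤ δ * dist (blk (n - 1) q) (blk (n - 1) w) + δ := by
    calc δ / (4 * n) * l1 (q - w) ≤ δ / (4 * n) * (4 * (n : ℝ) * dist (blk (n - 1) q) (blk (n - 1) w) + 4 * (n : ℝ)) :=
          mul_le_mul_of_nonneg_left h (div_nonneg hδ h4n.le)
      _ = δ * dist (blk (n - 1) q) (blk (n - 1) w) + δ := by field_simp
  linarith

/-- [our object] The constant of the coarse piece. -/
def cJ (n : ℕ) (a : ℝ) : ℝ := 4 / (n : ℝ) ^ 3 * cP 4 (n - 1) a * Real.exp (2 * deltaP 4 a)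

/-- [our object] The rate numerator of the coarse piece (fine rate `dJ a / n`). -/
def dJ (a : ℝ) : ℝ := deltaP 4 a / 4

/-- [folklore] `cJ ≥ 0`. -/
theorem cJ_nonneg [NeZero n] (ha : 0 < a) : 0 ≤ cJ n a := by
  unfold cJ; have := cP_nonneg 4 (n - 1) ha; positivity

/-- [folklore] `dJ > 0`. -/
theorem dJ_pos (ha : 0 < a) : 0 < dJ a := by unfold dJ; have := deltaP_pos 4 ha; positivity

/-- [folklore] **BI-LOCALISATION OF THE COARSE PIECE AT THE BOND**: `BiLoc (Jq n a κ′ u) u u (cJ n a) (dJ a / n)` — supported in `s` on the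
block of `u` (`|qJet| ≤ 4/n³`, `l1 (s − u) ≤ 4n`), decaying in `q` through `abs_kerP_le` (block rate `δ_P`, fine rate `δ_P/(4n)`). -/
theorem biLoc_Jq [NeZero n] (ha : 0 < a) : BiLoc (Jq n a κ' u) u u (cJ n a) (dJ a / n) := by
  have hn : (0 : ℝ) < n := Nat.cast_pos.mpr (Nat.pos_of_ne_zero (NeZero.ne n))
  have hδ := deltaP_pos 4 ha
  have hcP := cP_nonneg 4 (n - 1) ha
  have hrate : dJ a / n = deltaP 4 a / (4 * n) := by unfold dJ; field_simp
  intro s q v w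
  by_cases hs : blk (n - 1) u = blk (n - 1) s
  · have hsu : l1 (s - u) ≤ 4 * n := l1_sub_le_of_blk_eq n hs.symm
    have h1 := abs_qJet_le κ' u n (blk (n - 1) s) s
    have h2 := abs_kerP_le (d := 4) (n - 1) ha q (blk (n - 1) s)
    have h3 := exp_blk_le n hδ.le q u
    rw [hs] at h3
    have hE : Real.exp (-(deltaP 4 a / (4 * n)) * l1 (q - u)) ≤
        Real.exp (deltaP 4 a) * Real.exp (-(dJ a / n) * (l1 (s - u) + l1 (q - u))) := by
      rw [hrate, ← Real.exp_add, Real.exp_le_exp]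
      have : deltaP 4 a / (4 * n) * l1 (s - u) ≤ deltaP 4 a := by
        calc deltaP 4 a / (4 * n) * l1 (s - u) ≤ deltaP 4 a / (4 * n) * (4 * n) :=
              mul_le_mul_of_nonneg_left hsu (div_nonneg hδ.le (by positivity))
          _ = deltaP 4 a := by field_simp
      nlinarith
    rw [Jq_apply, abs_neg, abs_mul]
    calc |qJet n κ' u (blk (n - 1) s) s| * |kerP (d := 4) (n - 1) a q (blk (n - 1) s)|
        ≤ 4 / (n : ℝ) ^ 3 * (cP 4 (n - 1) a * Real.exp (-(deltaP 4 a * dist (blk (n - 1) q) (blk (n - 1) s)))) :=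
          mul_le_mul h1 h2 (abs_nonneg _) (by positivity)
      _ ≤ 4 / (n : ℝ) ^ 3 * (cP 4 (n - 1) a * (Real.exp (deltaP 4 a) * Real.exp (-(deltaP 4 a / (4 * n)) * l1 (q - u)))) :=
          mul_le_mul_of_nonneg_left (mul_le_mul_of_nonneg_left h3 hcP) (by positivity)
      _ ≤ 4 / (n : ℝ) ^ 3 * (cP 4 (n - 1) a * (Real.exp (deltaP 4 a) *
            (Real.exp (deltaP 4 a) * Real.exp (-(dJ a / n) * (l1 (s - u) + l1 (q - u)))))) :=
          mul_le_mul_of_nonneg_left (mul_le_mul_of_nonneg_left (mul_le_mul_of_nonneg_left hE (Real.exp_pos _).le) hcP) (by positivity)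
      _ = cJ n a * Real.exp (-(dJ a / n) * (l1 (s - u) + l1 (q - u))) := by
          rw [cJ, show (2 : ℝ) * deltaP 4 a = deltaP 4 a + deltaP 4 a by ring, Real.exp_add]; ring
  · rw [Jq_eq_zero_of_ne n a κ' u hs, abs_zero]
    exact mul_nonneg (cJ_nonneg n a ha) (Real.exp_pos _).le

/-- [folklore] **BLOCK-TRANSLATION COVARIANCE OF THE COARSE PIECE**, given the block covariance of `kerP` (binder `hkerP`: leaf-05-g3's
J5-asm is to expose it on the way to `shiftK_Pgt`; `qJet_translate`, `blk_translate'` BY NAME):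
`Jq n a κ′ (u + n•t) = shiftK (−(n•t)) (Jq n a κ′ u)`. -/
theorem Jq_translate [NeZero n]
    (hkerP : ∀ q y t : Site 4, kerP (d := 4) (n - 1) a (q + (n : ℤ) • t) (y + t) = kerP (d := 4) (n - 1) a q y) (t : Site 4) :
    Jq n a κ' (u + (n : ℤ) • t) = shiftK (-((n : ℤ) • t)) (Jq n a κ' u) := by
  funext s q v w
  show Jq n a κ' (u + (n : ℤ) • t) s q v w = Jq n a κ' u (s + -((n : ℤ) • t)) (q + -((n : ℤ) • t)) v w
  rw [Jq_apply, Jq_apply]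
  set s' := s + -((n : ℤ) • t) with hs'
  set q' := q + -((n : ℤ) • t) with hq'
  have es : s = s' + (n : ℤ) • t := by rw [hs', neg_add_cancel_right]
  have eq : q = q' + (n : ℤ) • t := by rw [hq', neg_add_cancel_right]
  rw [es, eq, blk_translate', qJet_translate, hkerP]

end Coarse

/-! ## §4 The instance: the stripped site jet of `R(U)` at `U = 1` -/

section Instance

variable (n : ℕ) [NeZero n] (a cK cQ : ℝ) (κ' : Fin 4) (u : Site 4)

/-- [our object] **`Rdot n a cK cQ κ′ u` — THE COLOUR-STRIPPED SITE JET OF BAŁABAN'S `R(U)` AT `U = 1` ALONG THE FINE BOND `⟨u, u+e_κ′⟩`**: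
`rdotOf (Ggh n a) (Pgt n a) (Sgh n cK cQ κ′ u) (Jq n a κ′ u)`.  A definition; asserts nothing (its justification is the model-level
`ProjectorJet`/`ProjectorJetDeriv`/`ProjectorJetStripped` chain; the kernel-level Leibniz identities are part 2). -/
def Rdot : MKer 4 Unit := rdotOf (Ggh n a) (Pgt n a) (Sgh n cK cQ κ' u) (Jq n a κ' u)

/-- [our object] Unfolding. -/
theorem Rdot_def : Rdot n a cK cQ κ' u = rdotOf (Ggh n a) (Pgt n a) (Sgh n cK cQ κ' u) (Jq n a κ' u) := rfl

/-- [folklore] **ANTISYMMETRY OF THE JET**: `Rdot … κ′ u z x = −Rdot … κ′ u x z`. -/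
theorem Rdot_antisymm (x z : Site 4) (v w : Unit) : Rdot n a cK cQ κ' u z x w v = -Rdot n a cK cQ κ' u x z v w :=
  rdotOf_antisymm _ _ _ _ x z v w

/-- [folklore] The same as `trK`. -/
theorem trK_Rdot : trK (Rdot n a cK cQ κ' u) = -Rdot n a cK cQ κ' u := trK_rdotOf _ _ _ _

/-- [our object] The common fine rate numerator: `dR a := min (δ_u(4,a)/4) (dJ a)` (the jet's rate is `dR a/(8n)`). -/
def dR (a : ℝ) : ℝ := min (deltaU 4 a / 4) (dJ a)

/-- [folklore] `dR > 0`. -/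
theorem dR_pos (ha : 0 < a) : 0 < dR a := lt_min (by have := deltaU_pos 4 ha; positivity) (dJ_pos a ha)

/-- [our object] The stencil constant at the common rate (T6's `biLoc_Sgh` with `δ := dR a`). -/
def cV (n : ℕ) (a cK cQ : ℝ) : ℝ := |cK| * Real.exp (dR a / n) + |cQ| * (8 / (n : ℝ) ^ 3 * Real.exp (8 * dR a))

/-- [our object] **THE CONSTANT OF THE JET** (explicit function of `n, a, cK, cQ` and of the projector's decay constant `CP`). -/
def cRdotInst (n : ℕ) (a cK cQ CP : ℝ) : ℝ := cRdot (2 / min 2 a) CP (cV n a cK cQ) (cJ n a) (dR a / n)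

/-- [folklore] **BI-LOCALISATION OF THE JET AT ITS BOND** — GIVEN the fine `ℓ¹` decay of the projector `Pgt n a` at the common rate
(binder `hP`; leaf-05-g3's `decays_Pgt`, weakened by `TameKernelCalculus.decays_of_le`, discharges it):
`BiLoc (Rdot n a cK cQ κ′ u) u u (cRdotInst n a cK cQ CP) (dR a/(8n))`. -/
theorem biLoc_Rdot (ha : 0 < a) {CP : ℝ} (hP : Decays (Pgt n a) CP (dR a / n)) :
    BiLoc (Rdot n a cK cQ κ' u) u u (cRdotInst n a cK cQ CP) (dR a / n / 8) := by
  have hn : (0 : ℝ) < n := Nat.cast_pos.mpr (Nat.pos_of_ne_zero (NeZero.ne n))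
  have hdR := dR_pos a ha
  have hG : Decays (Ggh n a) (2 / min 2 a) (dR a / n) := by
    have e : deltaU 4 a / (4 * n) = (deltaU 4 a / 4) / n := by ring
    have h := decays_of_le (decays_Ggh n a ha) (show dR a / n ≤ deltaU 4 a / (4 * n) by
      rw [e]; exact div_le_div_of_nonneg_right (min_le_left _ _) hn.le)
    rwa [abs_of_nonneg (const_nonneg a ha)] at h
  have hV : BiLoc (Sgh n cK cQ κ' u) u u (cV n a cK cQ) (dR a / n) := biLoc_Sgh κ' u n cK cQ hdR.le
  have hJ : BiLoc (Jq n a κ' u) u u (cJ n a) (dR a / n) := by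
    have h := biLoc_of_le (biLoc_Jq n a κ' u ha) (show dR a / n ≤ dJ a / n by
      exact div_le_div_of_nonneg_right (min_le_right _ _) hn.le)
    rwa [abs_of_nonneg (cJ_nonneg n a ha)] at h
  exact biLoc_rdotOf hG hP hV hJ (by positivity)

/-- [folklore] The packaged socket for leaf-05-g3's `RjetOf`: ONE constant for ALL bonds. -/
theorem exists_biLoc_Rdot (ha : 0 < a) {CP : ℝ} (hP : Decays (Pgt n a) CP (dR a / n)) :
    ∃ C : ℝ, ∀ (κ' : Fin 4) (u : Site 4), BiLoc (Rdot n a cK cQ κ' u) u u C (dR a / n / 8) :=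
  ⟨cRdotInst n a cK cQ CP, fun κ' u => biLoc_Rdot n a cK cQ κ' u ha hP⟩

/-- [folklore] **BLOCK-TRANSLATION COVARIANCE OF THE JET** — GIVEN the block covariance of the projector and of `kerP` (binders `hPs`,
`hkerP`; leaf-05-g3's J5-asm): `Rdot … κ′ (u + n•t) = shiftK (−(n•t)) (Rdot … κ′ u)` (the `hS` shape of `OneStepKernelFamily.vertexOfK_translate`). -/
theorem Rdot_translate (ha : 0 < a) (hPs : ∀ t : Site 4, shiftK (-((n : ℤ) • t)) (Pgt n a) = Pgt n a)
    (hkerP : ∀ q y t : Site 4, kerP (d := 4) (n - 1) a (q + (n : ℤ) • t) (y + t) = kerP (d := 4) (n - 1) a q y) (t : Site 4) :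
    Rdot n a cK cQ κ' (u + (n : ℤ) • t) = shiftK (-((n : ℤ) • t)) (Rdot n a cK cQ κ' u) := by
  rw [Rdot, Rdot, Sgh_translate, Jq_translate n a κ' u hkerP]
  exact rdotOf_shiftK (shiftK_Ggh_neg n a ha t) (hPs t) _ _

end Instance

end

end Summit.QuantumFields.BalabanUV.Beta.D1BFx.RProjectorJet
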